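import Summits.KontsevichZagierPeriods.Zeta5Search.Certificates.RayC1KernelClassCWR1A
import Summits.KontsevichZagierPeriods.Zeta5Search.Certificates.RayC1KernelClassCWR1B
import Summits.KontsevichZagierPeriods.Zeta5Search.Certificates.RayC1KernelClassCWR2A
import Summits.KontsevichZagierPeriods.Zeta5Search.Certificates.RayC1KernelClassCWR2B
import Summits.KontsevichZagierPeriods.Zeta5Search.Certificates.RayC1KernelClassCWR2D
import Summits.KontsevichZagierPeriods.Zeta5Search.Certificates.RayC1KernelClassCWR3P5
import Summits.KontsevichZagierPeriods.Zeta5Search.Certificates.RayC1KernelClassCWR3P6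
import Summits.KontsevichZagierPeriods.Zeta5Search.Certificates.RayC1KernelClassCWR4P10
import Summits.KontsevichZagierPeriods.Zeta5Search.Certificates.RayC1KernelClassCWR4P7
import Summits.KontsevichZagierPeriods.Zeta5Search.Certificates.RayC1KernelClassCWR4P8
import Summits.KontsevichZagierPeriods.Zeta5Search.Certificates.RayC1KernelClassCWR4P9
import Summits.KontsevichZagierPeriods.Zeta5Search.Certificates.RayC1KernelClassCWR5P11
import HarnessLib

/-!
# ζ(5) search — certificates: the CLASS-LAW WINDOW LIST of the ray RayC1, consumption round R5 (TYPER g17)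

HONEST FRAMING: systematic search; no irrationality claim unless certified.  `p`-adic bookkeeping; nothing about `ζ(5)`.

OUR work (Summit side; typer seat, generation 17; generator `HOME/pub-zeta5-typer-g17/gen/gen_classround.py C1 … R5`).  The list
`c1CWR5` of the 132 PROVED windows consumed in round R5 (= the landed adapter chunks `c1CWR1_0`, `c1CWR1_1`, `c1CWR2_3`, `c1CWR2_0`, `c1CWR2_1`, `c1CWR3_5`, `c1CWR3_6`, `c1CWR4_7`, `c1CWR4_8`, `c1CWR4_9`, `c1CWR4_10`, `c1CWR5_11`)
and `c1CWR5_holds : ∀ c ∈ c1CWR5, c.Holds` — the hypothesis of `soundChecker_entryOK` for this round's table.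
-/

noncomputable section

namespace Summit.KontsevichZagierPeriods.Zeta5Search.RayC1

open Summit.KontsevichZagierPeriods.Zeta5Search.RayKernel

/-- **The class-law window list of round R5.** -/
def c1CWR5 : List CWin := c1CWR1_0 ++ c1CWR1_1 ++ c1CWR2_3 ++ c1CWR2_0 ++ c1CWR2_1 ++ c1CWR3_5 ++ c1CWR3_6 ++ c1CWR4_7 ++ c1CWR4_8 ++ c1CWR4_9 ++ c1CWR4_10 ++ c1CWR5_11

/-- **Every window holds** (the landed window theorems, by name). -/
theorem c1CWR5_holds : ∀ c ∈ c1CWR5, c.Holds := by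
  intro c hc
  simp only [c1CWR5, List.mem_append, or_assoc] at hc
  rcases hc with h0 | h1 | h2 | h3 | h4 | h5 | h6 | h7 | h8 | h9 | h10 | h11
  · exact c1CWR1_0_holds c h0
  · exact c1CWR1_1_holds c h1
  · exact c1CWR2_3_holds c h2
  · exact c1CWR2_0_holds c h3
  · exact c1CWR2_1_holds c h4
  · exact c1CWR3_5_holds c h5
  · exact c1CWR3_6_holds c h6
  · exact c1CWR4_7_holds c h7
  · exact c1CWR4_8_holds c h8
  · exact c1CWR4_9_holds c h9
  · exact c1CWR4_10_holds c h10
  · exact c1CWR5_11_holds c h11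

end Summit.KontsevichZagierPeriods.Zeta5Search.RayC1
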